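import Summits.Ventures.PercRepro.RankLevelSetLevelSixHeavyCellSq27DI
import Summits.Ventures.PercRepro.RankLevelSetLevelSixCapGlue25
import Summits.Ventures.PercRepro.TriangleCapEightI
import Summits.Ventures.PercRepro.S1TrianglePlusSharp
import Summits.Ventures.PercRepro.S1SeriesLever14
import Summits.Ventures.PercRepro.RankLevelSetLevelSixArithHeavySq22DN9A

/-!
# PercRepro — THE 24 ROW, THE COLOOP CASE AT CORANK `9`, LEVEL TWO: THE TWICE-SCALED CELL `(p ≥ 22, 9)`, EVERY CORE (p8 g10, S3)

`proofs/SUBCLAIM-S3-p8.md` §3x. `(Φ(p+2, 6)/4)·#U ≤ #Y` on every `e`-free core of rank `p ≥ 22`, corank `9` (the corrected cell with `D = C(p + 8, 6)`, the parts ArithHeavySq22DN9A and the nullity-only caps). Axioms: standard.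
-/

open scoped Matroid

namespace PercRepro

namespace ThmN

open Set

variable {α : Type}

/-- **THE 24 ROW, THE COLOOP CASE AT CORANK `9`, LEVEL TWO: THE TWICE-SCALED CELL `(p ≥ 22, 9)`, EVERY CORE**: ratio `0.973`. -/
theorem c025_core_six_scaled2_basis_sq22s9 (M : Matroid α) [M.Finite] (p : ℕ) (hp : 22 ≤ p)
    (hR : M.eRank = (p : ℕ∞)) (hn : M.E.ncard = p + 9)
    (hfree : ∀ e ∈ M.E, ∃ A ⊆ M.E \ {e}, e ∉ M.closure A ∧ e ∉ M.closure ((M.E \ {e}) \ A)) :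
    phiK (p + 2) 6 / 4 * (Matroid.topCount M p 6 : ℚ) ≤ (Matroid.midCount M p 6 : ℚ) := by
  have hd : M.E.encard = M.eRank + (9 : ℕ) := by
    rw [hR, ← M.ground_finite.cast_ncard_eq, hn]
    push_cast
    ring
  have hL : ∀ e ∈ M.E, ¬ M.IsLoop e := not_isLoop_of_free M hfree
  have hs : ∀ e ∈ M.E, ∀ f ∈ M.E, e ≠ f → M.eRk {e, f} = 2 := by
    intro e he f hf hef
    have h2 : (2 : ℕ∞) ≤ M.eRk {e, f} :=
      two_le_eRk_of_two_le_ncard_of_free M hfree (pair_subset he hf) (by rw [ncard_pair hef])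
    have h3 : M.eRk {e, f} ≤ 2 := by
      have := M.eRk_le_encard {e, f}
      rwa [encard_pair hef] at this
    exact le_antisymm h3 h2
  have hC1 : ∀ L ⊆ M.E, M.eRk L = 2 → L.ncard ≤ 3 :=
    fun L hL hr => ncard_le_three_of_eRk_two M hs hfree hL hr
  have hC2 : ∀ P ⊆ M.E, M.eRk P ≤ 3 → P.ncard ≤ 6 :=
    fun P hP hr => ncard_le_six_of_eRk_le_three_of_free M hfree hP hr
  have hΦ : phiK (p + 2) 6 / 4 ≤ (2 : ℚ) ^ (p + 6) / (((p + 8).choose 6 : ℕ) : ℚ) := phiK_add_two_div_four_le p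
  exact c025_core_six_heavy_cell_sq27di M p 9 8 1 1 16 14 0 39774 1000 15 910 123 16
      ((p + 8).choose 6) (Nat.choose_pos (by omega)) (phiK (p + 2) 6 / 4) hΦ (by norm_num) (by omega)
      (by norm_num) (by norm_num) (by norm_num) (by norm_num) (by norm_num)
      (by norm_num [cnull]) (by norm_num [cnull]) (Or.inl (by norm_num)) (Or.inr (Or.inl ⟨by norm_num, by norm_num⟩)) (Or.inl (by norm_num)) (by norm_num) (by norm_num) (by norm_num)
      ((TriangleCap.core_ncard_triangles_le_cq3 M hfree hd).trans (by decide))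
      ((ncard_fourCircuits_le_avgChain14 9 M hfree hd).trans (by decide))
      ((S1.ncard_fiveCircuits_le_avgChain5c 9 M hfree hd).trans (by decide))
      (Or.inl (tail_six_heavy_sq22DN9_9 p hp)) hR hn hfree (level_six_poly_heavy_sq22DN9_9 p hp)

end ThmN

end PercRepro
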